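import Mathlib
import HarnessLib
import Literature.Analysis.FluidPDE.LocalTypeIScaling

/-!
# Route HardyPointSink — support `ABForwardHardy` (item stmt-NavierStokesRegularity-7983), file 8:
# scale and translation invariance of the local Hardy functional

Eighth helper file for the forward direction of Albritton–Barker 2019, Thm. 1.1 carrying the
Hardy bound (item stmt-NavierStokesRegularity-7983: "the local Hardy functional is invariant
under the NS scaling and translation, the rescaled balls exhaust `ℝ³`").  For the Navier–Stokes
zoom `v(s, y) = c u(t₀ + c² s, x₀ + c y)`:
`∫_{B(0,R)} |v(s,y)|² |y − y₀|⁻¹ dy = ∫_{B(x₀, cR)} |u(t₀ + c² s, x)|² |x − (x₀ + c y₀)|⁻¹ dx`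
(`hardy_zoom`), and consequently the local Hardy bound of `u` in the unit parabolic ball is
inherited, with the same constant, by every term of a blow-up sequence on every ball `B(0, R)`
and for every centre `y₀`, for all large indices (`hardy_approximants`).

## References

* D. Albritton, T. Barker, J. Math. Fluid Mech. 21 (2019) = arXiv:1811.00502, §3.
* L. Caffarelli, R. Kohn, L. Nirenberg, Comm. Pure Appl. Math. 35 (1982), §8 (weighted norms).
-/

noncomputable section

open MeasureTheory Set Function Filter Topology TopologicalSpace Metric Module
open scoped NNReal ENNReal
open Literature.Analysis Literature.Analysis.FluidPDE

-- single-problem summit: the namespace repeats the summit name by design (CONVENTIONS §1)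
set_option linter.dupNamespace false

namespace Summit.NavierStokesRegularity.NavierStokesRegularity.Theorems.HardyPointSinkABForwardHardy

local notation "E³" => EuclideanSpace ℝ (Fin 3)

/-- **Invariance of the local Hardy functional under the Navier–Stokes zoom.** For `c > 0`,
`v = c • u ∘ Φ`, `Φ(s, y) = (t₀ + c² s, x₀ + c y)`:
`∫_{B(0,R)} ‖v(s,y)‖² ‖y − y₀‖⁻¹ dy = ∫_{B(x₀, cR)} ‖u(t₀ + c² s, x)‖² ‖x − (x₀ + c y₀)‖⁻¹ dx`. -/
theorem hardy_zoom (u : ℝ → E³ → E³) {c : ℝ} (hc : 0 < c) (t₀ : ℝ) (x₀ : E³) (s : ℝ) (y₀ : E³)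
    (R : ℝ) :
    ∫⁻ y in ball (0 : E³) R, ‖(c • stPull (c ^ 2) c t₀ x₀ u) s y‖ₑ ^ 2 / ‖y - y₀‖ₑ =
      ∫⁻ x in ball x₀ (c * R), ‖u (t₀ + c ^ 2 * s) x‖ₑ ^ 2 / ‖x - (x₀ + c • y₀)‖ₑ := by
  have hc0 : c ≠ 0 := hc.ne'
  -- the integrand pulled back
  set F : E³ → ℝ≥0∞ := fun x => ‖c • u (t₀ + c ^ 2 * s) x‖ₑ ^ 2 / ‖c⁻¹ • (x - x₀) - y₀‖ₑ with hF
  have hpre : (fun y : E³ => x₀ + c • y) ⁻¹' ball x₀ (c * R) = ball (0 : E³) R := by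
    rw [space_affine_preimage_ball hc, sub_self, smul_zero, mul_div_cancel_left₀ _ hc0]
  have hLHS : ∫⁻ y in ball (0 : E³) R, ‖(c • stPull (c ^ 2) c t₀ x₀ u) s y‖ₑ ^ 2 / ‖y - y₀‖ₑ =
      ∫⁻ y in (fun y : E³ => x₀ + c • y) ⁻¹' ball x₀ (c * R), F (x₀ + c • y) := by
    rw [hpre]
    refine lintegral_congr fun y => ?_
    simp only [hF, smul_stPull_apply, add_sub_cancel_left, smul_smul, inv_mul_cancel₀ hc0, one_smul]
  rw [hLHS, setLIntegral_preimage_comp_space_affine hc x₀ F, finrank_euclideanSpace_fin]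
  -- the integrand in the new variables
  have hFx : ∀ x, F x =
      ENNReal.ofReal (c ^ 3) * (‖u (t₀ + c ^ 2 * s) x‖ₑ ^ 2 / ‖x - (x₀ + c • y₀)‖ₑ) := by
    intro x
    have e1 : c⁻¹ • (x - x₀) - y₀ = c⁻¹ • (x - (x₀ + c • y₀)) := by
      rw [smul_sub, smul_sub, smul_add, smul_smul, inv_mul_cancel₀ hc0, one_smul]; abel
    simp only [hF, e1, enorm_smul, mul_pow]
    have hcn : ‖c‖ₑ = ENNReal.ofReal c := Real.enorm_eq_ofReal hc.le
    have hcn' : ‖c⁻¹‖ₑ = (ENNReal.ofReal c)⁻¹ := by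
      rw [Real.enorm_eq_ofReal (inv_nonneg.2 hc.le), ENNReal.ofReal_inv_of_pos hc]
    rw [hcn, hcn']
    have hc' : ENNReal.ofReal c ≠ 0 := (ENNReal.ofReal_pos.2 hc).ne'
    have hc'' : ENNReal.ofReal c ≠ ⊤ := ENNReal.ofReal_ne_top
    rw [div_eq_mul_inv, div_eq_mul_inv, ENNReal.mul_inv (Or.inl (ENNReal.inv_ne_zero.2 hc''))
      (Or.inl (ENNReal.inv_ne_top.2 hc')), inv_inv,
      show ENNReal.ofReal (c ^ 3) = ENNReal.ofReal c ^ 2 * ENNReal.ofReal c by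
        rw [← ENNReal.ofReal_pow hc.le, ← ENNReal.ofReal_mul (by positivity)]; ring_nf]
    ring
  simp_rw [hFx]
  rw [lintegral_const_mul' _ _ ENNReal.ofReal_ne_top, ← mul_assoc,
    ENNReal.ofReal_inv_of_pos (by positivity), ENNReal.inv_mul_cancel
      (ENNReal.ofReal_pos.2 (by positivity)).ne' ENNReal.ofReal_ne_top, one_mul]

/-- **The blow-up sequence inherits the local Hardy bound on every ball, eventually.**  Let
`v_k = λ_k u ∘ Φ_k` be zooms of a field `uh = u` a.e., around centres `z_k` with the closed
parabolic boxes of radius `2^{k+1} λ_k` inside `Q(0, 1)`, and let `u` satisfy the local Hardy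
bound `∫_{B(0,1)} |u(t,x)|² |x − x₀|⁻¹ dx ≤ K` for every `x₀ ∈ B(0, 1)` and a.e. `t ∈ (-1, 0)`.
Then for every `R > 0` and `y₀`, for all large `k`,
`∫_{B(0,R)} |v_k(s,y)|² |y − y₀|⁻¹ dy ≤ K` for a.e. `s ∈ (-R², 0)`. -/
theorem hardy_approximants {u uh : ℝ → E³ → E³} {v : ℕ → ℝ → E³ → E³} {zs : ℕ → ℝ × E³}
    {lam : ℕ → ℝ} {K : ℝ≥0∞} (hlam : ∀ k, 0 < lam k)
    (hae : ∀ᵐ w ∂(volume : Measure (ℝ × E³)), uncurry u w = uncurry uh w)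
    (hv : ∀ k, v k = lam k • stPull (lam k ^ 2) (lam k) (zs k).1 (zs k).2 uh)
    (hbox : ∀ k, Icc ((zs k).1 - ((2 : ℝ) ^ (k + 1) * lam k) ^ 2) (zs k).1 ×ˢ
      closedBall (zs k).2 ((2 : ℝ) ^ (k + 1) * lam k) ⊆ parabolicCylinder 1 (0 : ℝ × E³))
    (hH : ∀ x₀ ∈ ball (0 : E³) 1, ∀ᵐ t ∂(volume.restrict (Ioo (-1 : ℝ) 0)),
      ∫⁻ x in ball (0 : E³) 1, ‖u t x‖ₑ ^ 2 / ‖x - x₀‖ₑ ≤ K)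
    {R : ℝ} (hR : 0 < R) (y₀ : E³) :
    ∀ᶠ k in atTop, ∀ᵐ s ∂(volume.restrict (Ioo (-R ^ 2) 0)),
      ∫⁻ y in ball (0 : E³) R, ‖v k s y‖ₑ ^ 2 / ‖y - y₀‖ₑ ≤ K := by
  -- `u = uh` slice-wise a.e.
  have hae2 : ∀ᵐ t ∂(volume : Measure ℝ), ∀ᵐ x ∂(volume : Measure E³), u t x = uh t x := by
    have h : ∀ᵐ w ∂((volume : Measure ℝ).prod (volume : Measure E³)), uncurry u w = uncurry uh w := by
      rw [← Measure.volume_eq_prod]; exact hae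
    exact Measure.ae_ae_of_ae_prod h
  -- large `k`: `R ≤ 2^{k+1}` and `‖y₀‖ ≤ 2^{k+1}`
  have hev : ∀ᶠ k : ℕ in atTop, max R ‖y₀‖ ≤ (2 : ℝ) ^ (k + 1) := by
    obtain ⟨m, hm⟩ := pow_unbounded_of_one_lt (max R ‖y₀‖) (by norm_num : (1 : ℝ) < 2)
    refine eventually_atTop.2 ⟨m, fun k hk => hm.le.trans ?_⟩
    exact pow_le_pow_right₀ (by norm_num) (by omega)
  filter_upwards [hev] with k hk
  have hRk : R ≤ (2 : ℝ) ^ (k + 1) := (le_max_left _ _).trans hk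
  have hyk : ‖y₀‖ ≤ (2 : ℝ) ^ (k + 1) := (le_max_right _ _).trans hk
  set ρ : ℝ := (2 : ℝ) ^ (k + 1) * lam k with hρ
  have hρ0 : 0 < ρ := mul_pos (by positivity) (hlam k)
  have hlamR : lam k * R ≤ ρ := by rw [hρ, mul_comm]; exact mul_le_mul_of_nonneg_right hRk (hlam k).le
  -- geometry from the box
  have hxball : ∀ x ∈ closedBall (zs k).2 ρ, x ∈ ball (0 : E³) 1 := by
    intro x hx
    have h := hbox k (Set.mk_mem_prod (a := (zs k).1) (b := x) ⟨by nlinarith [hρ0], le_rfl⟩ hx)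
    rw [mem_parabolicCylinder] at h
    simpa using h.2
  have htime : Ioo ((zs k).1 + lam k ^ 2 * (-R ^ 2)) ((zs k).1 + lam k ^ 2 * 0) ⊆ Ioo (-1 : ℝ) 0 := by
    intro t ht
    have hlo : (zs k).1 - ρ ^ 2 ≤ t := by
      have : (lam k * R) ^ 2 ≤ ρ ^ 2 := pow_le_pow_left₀ (mul_pos (hlam k) hR).le hlamR 2
      nlinarith [ht.1]
    have hhi : t ≤ (zs k).1 := by nlinarith [ht.2]
    have h := hbox k (Set.mk_mem_prod (a := t) (b := (zs k).2) ⟨hlo, hhi⟩ (mem_closedBall_self hρ0.le))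
    rw [mem_parabolicCylinder] at h
    simp only [Prod.fst_zero, zero_sub] at h
    exact ⟨by nlinarith [h.1.1], h.1.2⟩
  -- the centre `x₀ = x_k + λ y₀` and the ball `B(x_k, λR)` lie in `B(0, 1)`
  set x₀ : E³ := (zs k).2 + lam k • y₀ with hx₀
  have hx₀ : x₀ ∈ ball (0 : E³) 1 := by
    refine hxball x₀ (mem_closedBall.2 ?_)
    rw [hx₀, dist_eq_norm, add_sub_cancel_left, norm_smul, Real.norm_of_nonneg (hlam k).le, hρ,
      mul_comm]
    exact mul_le_mul_of_nonneg_right hyk (hlam k).le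
  have hsub : ball (zs k).2 (lam k * R) ⊆ ball (0 : E³) 1 := fun x hx =>
    hxball x (mem_closedBall.2 ((mem_ball.1 hx).le.trans hlamR))
  -- the a.e.-in-time statement for `uh` on `(-1, 0)`
  have h1 : ∀ᵐ t ∂(volume.restrict (Ioo (-1 : ℝ) 0)),
      ∫⁻ x in ball (zs k).2 (lam k * R), ‖uh t x‖ₑ ^ 2 / ‖x - x₀‖ₑ ≤ K := by
    filter_upwards [hH x₀ hx₀, ae_restrict_of_ae (s := Ioo (-1 : ℝ) 0) hae2] with t ht ht'
    have e : ∫⁻ x in ball (zs k).2 (lam k * R), ‖uh t x‖ₑ ^ 2 / ‖x - x₀‖ₑ =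
        ∫⁻ x in ball (zs k).2 (lam k * R), ‖u t x‖ₑ ^ 2 / ‖x - x₀‖ₑ := by
      refine lintegral_congr_ae ?_
      filter_upwards [ae_restrict_of_ae (s := ball (zs k).2 (lam k * R)) ht'] with x hx
      rw [hx]
    rw [e]
    exact (lintegral_mono_set hsub).trans ht
  -- transported to `s ∈ (-R², 0)`
  have h2 := ae_restrict_Ioo_comp_time_affine (pow_pos (hlam k) 2) (zs k).1 (-R ^ 2) 0
    (ae_restrict_of_ae_restrict_of_subset htime h1)
  filter_upwards [h2] with s hs
  rw [hv k, hardy_zoom uh (hlam k)]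
  exact hs

end Summit.NavierStokesRegularity.NavierStokesRegularity.Theorems.HardyPointSinkABForwardHardy

end
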